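import Literature.MathematicalPhysics.QuantumFieldTheory.Balaban1983to89.B13Bound226Primitive

/-!
# `Balaban1983to89.B13Bound226Located` — T. Bałaban, *Renormalization group approach to lattice gauge field
theories. II. Cluster expansions*, Commun. Math. Phys. **116** (1988) 1–22 [Balaban1988RG2Cluster], pp. 15–17: the
bound (2.26) of the generic term (2.14) from the PRIMITIVE operators — the chain `B13Bound226From216` §1–§3 →
`B13Eq216FirstForm` §1, §3 → `B13Bound226Primitive` §2 — over an ARBITRARY located index geometry: the bonds of `Z₀`
(`Λ`) and of `Z` (`N = Λ ⊕ C₀`) are located by maps `locΛ`, `locN` in a site space `S` carrying a pseudo-distance `ρ`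
(zero diagonal, non-negative, triangle inequality — `B13PerturbativeStep.WeightHyp 0 ρ` — and symmetric) with a
UNIFORM LATTICE CONSTANT `Kc`: `Σ_{y ∈ T} e^{−bρ(x,y)} ≤ Kc(b)` for every finite `T ⊂ S`, every `x`, every rate
`b > 0`.  The files of record are the instance `S = ℤ^ν`, `ρ = |·−·|₁` (`B2Lemma25Proof.l1dist`), `Kc(b) = (1 + 2/b)^ν`
(`B2Lemma25Proof.sum_exp_neg_l1dist_le`; §6); the papers' carrier — the torus ([I] p. 251) with its ℓ¹ distance
`B9Thm37GlueTorus.tdist1` and `Kc(b) = c₀(1, b)^ν` (`B9Thm37GlueTorus.torusSum_tdist1_le`) — is the instance used by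
`B13Lemma3TorusPrimitive`.  Precedent for the abstraction: `B4Sect5Torus` (the Sect. 5 theorem of [B4] over an arbitrary
finite index set with a pseudo-distance; ℤ^d and the torus as instances).

statement-level skeleton of published theorems with citation tags; proofs where landed; nothing here is a claim about
the Yang–Mills mass gap

PDF held: `paper:balaban1988-cmp116-rg-ii-cluster` (journal page = PDF page + 0); pp. 15–17 (materialised
`p0015.txt`–`p0017.txt`, render `pub-balaban/b2b-balaban-ref1/pages/1988-cmp116-rg-II-cluster/…-p016-x2.png`, cell
transcript `pub-balaban/b2b-balaban-b13/transcript-B13.md` ll. 144–165).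

CITATION HEADER (verbatim, p. 15 [PDF 15] – p. 17 [PDF 17]): *"In the expression on the right-hand side we replace the
operators by the corresponding operators with σ(Z) = 0, 𝐔 = U, 𝐉 = 0, and we estimate the error. For the quadratic form
in the first exponential the difference is a quadratic form ½⟨X, R₁X⟩, with matrix elements satisfying the bound*
`|R₁(b, b′)| ≦ (O(1)e^{−⅓δ₀M} + O(α₀ + α₁)) exp(−½δ₀|b₋ − b′₋|).`  (2.16)" … p. 16 after (2.19): *"We use the first
exponential factor in (2.19) to bound the sum, and this yields a constant O(1)."* … p. 17: *"This ends the estimate of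
the expression (2.14). Gathering together all the bounds we get*
`|(2.14)| ≦ exp(−(κ₁ − 1)(LM)⁻⁴|Z∖Z′₀|)[Π_{Y∈𝐃} 2E₀ε₁C₁α₄⁻¹M^q exp C₂κ₁ exp(−(1 − 3δ)κd_k(Y))] exp(−½γ₂(ε₁²/g_k²)|P|) · exp O(1)α₅|Z|.`  (2.26)"

WHAT IS REPRODUCED (unit `lit-balaban-r10` gen 14, B13 fold owner; SKELETON rows `B13.Eq2.26`, `B13.Eq2.16`,
`B13.Eq2.15`, `B13.Eq2.21` of `HOME/lit-balaban-r10/ROWS-B13.md`, HOME = `run/shared/lean/pub/lit-balaban/`).  Every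
theorem below is the theorem of the same name in `B13Bound226From216` / `B13Eq216FirstForm` / `B13Bound226Primitive`
with `|loc i − loc j|₁` ↦ `ρ(loc i, loc j)` and the lattice constant `m(1 + 2/b)^ν` ↦ `m·Kc(b)`; the proofs are the
same compositions of the location-free theorems of `B13PerturbativeStep` (`WRS.of_entrywise`), `B13Replacement223`
(`hR1_of_WRS`, `hR2_of_WRS`, `hR3_of_rowSum`, `h17a_of_WRS`, `h17b_of_WRS`), `B13Bound226Assembly`
(`norm_core214_F214_le_K`) and `B13CauchyDecay` (`norm_term214_le_215`).
* §1 the lattice constant of a located index set (`sum_exp_neg_loc_le_pt`: `Σ_j e^{−bρ(x, loc j)} ≤ m·Kc(b)` when at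
  most `m` indices sit at each site), the admissible weight `weightHyp_loc`, entrywise decay ⇒ row sums
  (`WRS_of_entrywise_loc`, `…_transpose`, `WRS_zero_of_entrywise`, `rowSum_norm_le_of_entrywise`,
  `colSum_norm_le_of_entrywise`);
* §2 composition of located kernels (`conv_exp_le`, `entry_mul_le`, `entry_bound_mono_rate`, `entry_bound_transpose`,
  `entry_triple_le`) and **`h216R1_of_factors`**: (2.16) for `R₁ = Γ₀ᵀCΓ₀ − Re(GᵀC_σG)` from the (2.16)-type bounds of
  the difference kernels `G − Γ₀`, `C_σ − C` and the uniform localisation of `G`, `Γ₀`, `C_σ`, `C`, constant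
  `m·Kc(κ−κ′)·m·Kc(κ′−κ″)·(θ_ΓK_{Cσ}K_G + K_Γθ_CK_G + K_ΓK₀θ_Γ)` at the twice-dropped rate `κ″`;
* §3 the replacement hypotheses `hR1`, `hR2`, `hR3`, `h17a`, `h17b` of `B13Bound226Assembly` from the ENTRYWISE (2.16);
* §4 the sup bound of the last three lines of (2.14) and (2.26) for the typed term with (2.16) entrywise
  (`norm_core214_F214_le_K_of_216`, `norm_term214_le_226_of_216`);
* §5 the capstone **`norm_term214_le_226_of_primitives`** — (2.26) for `B13Term214.term214 r lZ lD (core214 A Γ (F214 …))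
  σ₀ τ₀` from separate analyticity, the (2.20)/(2.22) shapes, `A(σ)` symmetric with `Re A(σ) ≻ 0`, the `Γ`-operator
  linear with kernel `G(σ)`, and — uniformly on the σ-polydisc, on located bonds, at rate `κ` — the localisation of
  `G(σ)`, `Γ₀`, `A(σ)⁻¹`, `C` and the (2.16)-type bounds of `G(σ) − Γ₀`, `A(σ)⁻¹ − C`, `A(σ) − C⁻¹`, with the smallness
  `K′θ′ < 1`, `α₅c ≤ ½`, `α₅(1 + 2cg) ≤ ½` (`K′ = K₀m·Kc(κ)`, `θ′ = θm·Kc(κ″)`, `α₅ = 2θ′ + γ₂ + a`);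
* §6 the instance of record: on `S = ℤ^ν` with `ρ = |·−·|₁` the four geometric hypotheses hold with `Kc(b) = (1 + 2/b)^ν`
  (`weightHyp_l1`, `l1_symm`, `kc_l1`, `kc_l1_nonneg`), so that §5 at this instance is LITERALLY
  `B13Bound226Primitive.norm_term214_le_226_of_primitives` (same constants).
HONEST SCOPE.  A generalisation of landed plumbing, no new analysis: finite-dimensional kernel algebra over an abstract
pseudo-metric site space.  By-assertion inputs are unchanged (for the typed generic term: the localisation and
difference bounds of the PRIMITIVE operators `C^{(k)}(Z₀, σ)`, its inverse, `Γ_k(Z₀, σ)` — cross-paper [13]/[15], loci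
L16a/L17a of the cell transcript, print's σ-part `O(1)e^{−⅓δ₀M}` —, the letters `c`, `g`, (2.20)/(2.22) in their
printed shapes, separate analyticity; upstream the (2.14)-representation of H(Z), `B13Representation214`).  No `sorry`,
no definition, no new named fact (D-0026).
-/

noncomputable section

namespace Literature.MathematicalPhysics.QuantumFieldTheory.Balaban1983to89.B13Bound226Located

open Complex MeasureTheory Metric Finset Matrix
open B2Lemma25Proof (l1dist l1dist_nonneg l1dist_comm sum_exp_neg_l1dist_le)
open B13PerturbativeStep (WRS WeightHyp)
open B13Term214 (SepHolOn term214 core214 F214)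
open B13Replacement223 (hR1_of_WRS hR2_of_WRS hR3_of_rowSum h17a_of_WRS h17b_of_WRS)
open B13Bound226Assembly (norm_core214_F214_le_K)
open B13CauchyDecay (norm_term214_le_215)
open B13Eq216FirstForm (exp_mul_exp_le_split hdef1_of_linear triple_sub_triple entry_bound_map_ofReal)
open B13Bound226Primitive (hdef3_of_linear h216R3_of_diff continuous_of_linear)

/-! ## §1. The lattice constant of a located index set; entrywise decay ⇒ row sums -/

section Lattice

variable {S : Type*} [DecidableEq S] {ρ : S → S → ℝ} {Kc : ℝ → ℝ}
variable {n p : Type*} [Fintype n] {𝕜 : Type*} [RCLike 𝕜]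

omit [DecidableEq S] [Fintype n] in
/-- The lattice constant is non-negative at every positive rate (take `T = ∅`). [folklore]
[cite: Balaban1988RG2Cluster, p.16 after (2.19) ("this yields a constant O(1)")] -/
theorem Kc_nonneg (hKc : ∀ b : ℝ, 0 < b → ∀ (T : Finset S) (x : S), ∑ y ∈ T, Real.exp (-(b * ρ x y)) ≤ Kc b)
    {b : ℝ} (hb : 0 < b) (x : S) : 0 ≤ Kc b := by
  simpa using hKc b hb ∅ x

/-- **The lattice constant of a located index set, from an arbitrary base point.**  If `loc : n → S` places at most
`m` indices at each site, then for every `x ∈ S` and rate `b > 0`, `Σ_j e^{−bρ(x, loc j)} ≤ m·Kc(b)` (group the sum by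
sites) — the printed *"Σ_{b′} e^{−(κ−κ′)|b₋ − b′₋|} = O(1)"* with the O(1) of the site space. [cite: Balaban1988RG2Cluster, (2.16) p.16 and p.16 after (2.19)] -/
theorem sum_exp_neg_loc_le_pt
    (hKc : ∀ b : ℝ, 0 < b → ∀ (T : Finset S) (x : S), ∑ y ∈ T, Real.exp (-(b * ρ x y)) ≤ Kc b)
    {b : ℝ} (hb : 0 < b) (loc : n → S) {m : ℕ}
    (hfib : ∀ x : S, (Finset.univ.filter fun j => loc j = x).card ≤ m) (x : S) :
    ∑ j, Real.exp (-(b * ρ x (loc j))) ≤ m * Kc b := by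
  classical
  have hfw := Finset.sum_fiberwise_of_maps_to (s := (Finset.univ : Finset n)) (t := Finset.univ.image loc)
    (g := loc) (fun j hj => Finset.mem_image_of_mem loc hj) (fun j => Real.exp (-(b * ρ x (loc j))))
  rw [← hfw]
  calc ∑ y ∈ Finset.univ.image loc, ∑ j ∈ Finset.univ.filter (fun j => loc j = y),
        Real.exp (-(b * ρ x (loc j)))
      = ∑ y ∈ Finset.univ.image loc,
          ((Finset.univ.filter fun j => loc j = y).card : ℝ) * Real.exp (-(b * ρ x y)) := by
        refine Finset.sum_congr rfl fun y _ => ?_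
        have hc : ∀ j ∈ Finset.univ.filter (fun j => loc j = y),
            Real.exp (-(b * ρ x (loc j))) = Real.exp (-(b * ρ x y)) := fun j hj => by
          rw [(Finset.mem_filter.1 hj).2]
        rw [Finset.sum_congr rfl hc, Finset.sum_const, nsmul_eq_mul]
    _ ≤ ∑ y ∈ Finset.univ.image loc, (m : ℝ) * Real.exp (-(b * ρ x y)) :=
        Finset.sum_le_sum fun y _ => mul_le_mul_of_nonneg_right (by exact_mod_cast hfib y) (Real.exp_pos _).le
    _ = m * ∑ y ∈ Finset.univ.image loc, Real.exp (-(b * ρ x y)) := by rw [Finset.mul_sum]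
    _ ≤ m * Kc b := mul_le_mul_of_nonneg_left (hKc b hb _ x) (Nat.cast_nonneg m)

omit [DecidableEq S] [Fintype n] in
/-- **The pseudo-distance of located indices is an admissible weight** (`B13PerturbativeStep.WeightHyp`: κ′ ≥ 0,
d(i,i) = 0, d ≥ 0, triangle inequality). [cite: Balaban1988RG2Cluster, (2.16) p.16 (the weight e^{−δ₀|b₋−b′₋|})] -/
theorem weightHyp_loc (hρ : WeightHyp 0 ρ) {κ' : ℝ} (hκ' : 0 ≤ κ') (loc : n → S) :
    WeightHyp κ' (fun i j => ρ (loc i) (loc j)) where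
  κ_nonneg := hκ'
  zero i := hρ.zero (loc i)
  nonneg i j := hρ.nonneg (loc i) (loc j)
  tri i j k := hρ.tri (loc i) (loc j) (loc k)

/-- **Entrywise decay ⇒ weighted row sums, with the lattice constant of the site space**: `‖A i j‖ ≤
θe^{−κρ(loc i, loc j)}` and `κ′ < κ` ⇒ `WRS κ′ ρ(loc ·, loc ·) A (θ·m·Kc(κ−κ′))` — `B13PerturbativeStep.WRS.of_entrywise`
with its hypothesis `hL` supplied by `sum_exp_neg_loc_le_pt`. [cite: Balaban1988RG2Cluster, (2.16) p.16 and p.16 after (2.19)] -/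
theorem WRS_of_entrywise_loc
    (hKc : ∀ b : ℝ, 0 < b → ∀ (T : Finset S) (x : S), ∑ y ∈ T, Real.exp (-(b * ρ x y)) ≤ Kc b)
    {A : Matrix n n 𝕜} {θ κ κ' : ℝ} (hθ : 0 ≤ θ) (hκ : κ' < κ) (loc : n → S) {m : ℕ}
    (hfib : ∀ x : S, (Finset.univ.filter fun j => loc j = x).card ≤ m)
    (hA : ∀ i j, ‖A i j‖ ≤ θ * Real.exp (-(κ * ρ (loc i) (loc j)))) :
    WRS κ' (fun i j => ρ (loc i) (loc j)) A (θ * (m * Kc (κ - κ'))) :=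
  B13PerturbativeStep.WRS.of_entrywise hθ hA fun i => sum_exp_neg_loc_le_pt hKc (sub_pos.2 hκ) loc hfib (loc i)

omit [DecidableEq S] [Fintype n] in
/-- An entrywise bound with a symmetric weight passes to the transpose; private plumbing. [folklore] -/
private theorem entrywise_transpose (hρs : ∀ x y : S, ρ x y = ρ y x) {A : Matrix n n 𝕜} {θ κ : ℝ} (loc : n → S)
    (hA : ∀ i j, ‖A i j‖ ≤ θ * Real.exp (-(κ * ρ (loc i) (loc j)))) :
    ∀ i j, ‖Aᵀ i j‖ ≤ θ * Real.exp (-(κ * ρ (loc i) (loc j))) := fun i j => by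
  rw [Matrix.transpose_apply, hρs (loc i) (loc j)]
  exact hA j i

/-- **The transposed kernel obeys the same row-sum bound** (the weight is symmetric). [cite: Balaban1988RG2Cluster, (2.16) p.16, (2.21) p.16] -/
theorem WRS_of_entrywise_loc_transpose
    (hKc : ∀ b : ℝ, 0 < b → ∀ (T : Finset S) (x : S), ∑ y ∈ T, Real.exp (-(b * ρ x y)) ≤ Kc b)
    (hρs : ∀ x y : S, ρ x y = ρ y x) {A : Matrix n n 𝕜} {θ κ κ' : ℝ} (hθ : 0 ≤ θ) (hκ : κ' < κ) (loc : n → S)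
    {m : ℕ} (hfib : ∀ x : S, (Finset.univ.filter fun j => loc j = x).card ≤ m)
    (hA : ∀ i j, ‖A i j‖ ≤ θ * Real.exp (-(κ * ρ (loc i) (loc j)))) :
    WRS κ' (fun i j => ρ (loc i) (loc j)) Aᵀ (θ * (m * Kc (κ - κ'))) :=
  WRS_of_entrywise_loc hKc hθ hκ loc hfib (entrywise_transpose hρs loc hA)

/-- **Entrywise decay ⇒ plain absolute row sums `≤ θ·m·Kc(κ)` for `A` and `Aᵀ`** (the row-sum form at rate `0`, which
is all the Schur bound (2.21) and the Leibniz bound (2.17) consume). [cite: Balaban1988RG2Cluster, (2.16) p.16 and p.16 after (2.19)] -/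
theorem WRS_zero_of_entrywise
    (hKc : ∀ b : ℝ, 0 < b → ∀ (T : Finset S) (x : S), ∑ y ∈ T, Real.exp (-(b * ρ x y)) ≤ Kc b)
    (hρs : ∀ x y : S, ρ x y = ρ y x) {A : Matrix n n 𝕜} {θ κ : ℝ} (hθ : 0 ≤ θ) (hκ : 0 < κ) (loc : n → S)
    {m : ℕ} (hfib : ∀ x : S, (Finset.univ.filter fun j => loc j = x).card ≤ m)
    (hA : ∀ i j, ‖A i j‖ ≤ θ * Real.exp (-(κ * ρ (loc i) (loc j)))) :
    WRS 0 (fun i j => ρ (loc i) (loc j)) A (θ * (m * Kc κ)) ∧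
      WRS 0 (fun i j => ρ (loc i) (loc j)) Aᵀ (θ * (m * Kc κ)) := by
  have h1 := WRS_of_entrywise_loc hKc hθ hκ loc hfib hA
  have h2 := WRS_of_entrywise_loc_transpose hKc hρs hθ hκ loc hfib hA
  rw [sub_zero] at h1 h2
  exact ⟨h1, h2⟩

/-- **Absolute row sums of a located rectangular kernel with entrywise decay** (`R₃`, bonds of `Z₀` × bonds of `Z`):
`‖R i j‖ ≤ θe^{−κρ(loc′ i, loc j)}`, `κ > 0`, at most `m` column indices per site ⇒ `Σ_j ‖R i j‖ ≤ θ·m·Kc(κ)`.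
[cite: Balaban1988RG2Cluster, (2.16) p.16, (2.21) p.16] -/
theorem rowSum_norm_le_of_entrywise
    (hKc : ∀ b : ℝ, 0 < b → ∀ (T : Finset S) (x : S), ∑ y ∈ T, Real.exp (-(b * ρ x y)) ≤ Kc b)
    {R : Matrix p n 𝕜} {θ κ : ℝ} (hθ : 0 ≤ θ) (hκ : 0 < κ) (locp : p → S) (locn : n → S) {m : ℕ}
    (hfib : ∀ x : S, (Finset.univ.filter fun j => locn j = x).card ≤ m)
    (hR : ∀ i j, ‖R i j‖ ≤ θ * Real.exp (-(κ * ρ (locp i) (locn j)))) (i : p) :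
    ∑ j, ‖R i j‖ ≤ θ * (m * Kc κ) :=
  calc ∑ j, ‖R i j‖ ≤ ∑ j, θ * Real.exp (-(κ * ρ (locp i) (locn j))) := Finset.sum_le_sum fun j _ => hR i j
    _ = θ * ∑ j, Real.exp (-(κ * ρ (locp i) (locn j))) := by rw [Finset.mul_sum]
    _ ≤ θ * (m * Kc κ) := mul_le_mul_of_nonneg_left (sum_exp_neg_loc_le_pt hKc hκ locn hfib (locp i)) hθ

omit [Fintype n] in
/-- **Absolute column sums of a located rectangular kernel with entrywise decay**: `‖R i j‖ ≤ θe^{−κρ(loc′ i, loc j)}`,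
`κ > 0`, at most `m` ROW indices per site ⇒ `Σ_i ‖R i j‖ ≤ θ·m·Kc(κ)` (the weight is symmetric).
[cite: Balaban1988RG2Cluster, (2.16) p.16, (2.21) p.16] -/
theorem colSum_norm_le_of_entrywise [Fintype p]
    (hKc : ∀ b : ℝ, 0 < b → ∀ (T : Finset S) (x : S), ∑ y ∈ T, Real.exp (-(b * ρ x y)) ≤ Kc b)
    (hρs : ∀ x y : S, ρ x y = ρ y x) {R : Matrix p n 𝕜} {θ κ : ℝ} (hθ : 0 ≤ θ) (hκ : 0 < κ) (locp : p → S)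
    (locn : n → S) {m : ℕ} (hfib : ∀ x : S, (Finset.univ.filter fun i => locp i = x).card ≤ m)
    (hR : ∀ i j, ‖R i j‖ ≤ θ * Real.exp (-(κ * ρ (locp i) (locn j)))) (j : n) :
    ∑ i, ‖R i j‖ ≤ θ * (m * Kc κ) :=
  calc ∑ i, ‖R i j‖ ≤ ∑ i, θ * Real.exp (-(κ * ρ (locn j) (locp i))) :=
        Finset.sum_le_sum fun i _ => by rw [hρs]; exact hR i j
    _ = θ * ∑ i, Real.exp (-(κ * ρ (locn j) (locp i))) := by rw [Finset.mul_sum]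
    _ ≤ θ * (m * Kc κ) := mul_le_mul_of_nonneg_left (sum_exp_neg_loc_le_pt hKc hκ locp hfib (locn j)) hθ

end Lattice

/-! ## §2. Composition of located kernels; (2.16) for `R₁` from the bounds of the primitive kernels -/

section Composition

variable {S : Type*} [DecidableEq S] {ρ : S → S → ℝ} {Kc : ℝ → ℝ}
variable {n p q : Type*} [Fintype n] {𝕜 : Type*} [RCLike 𝕜]

/-- **Composition of two located exponential weights.**  If `loc : n → S` has at most `m` indices per site and
`0 ≤ κ′ < κ`, then for all `x, y ∈ S`:  `Σ_j e^{−κρ(x, loc j)}·e^{−κρ(loc j, y)} ≤ m·Kc(κ − κ′)·e^{−κ′ρ(x, y)}` — the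
composite of two rate-`κ` weights decays at any smaller rate `κ′`, with the lattice constant of the surplus rate
(triangle inequality + `sum_exp_neg_loc_le_pt`). [folklore] [cite: Balaban1988RG2Cluster, (2.16) p.16] -/
theorem conv_exp_le (hρ : WeightHyp 0 ρ)
    (hKc : ∀ b : ℝ, 0 < b → ∀ (T : Finset S) (x : S), ∑ y ∈ T, Real.exp (-(b * ρ x y)) ≤ Kc b)
    (loc : n → S) {m : ℕ} (hfib : ∀ x : S, (Finset.univ.filter fun j => loc j = x).card ≤ m) {κ κ' : ℝ}
    (hκ' : 0 ≤ κ') (hlt : κ' < κ) (x y : S) :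
    ∑ j, Real.exp (-(κ * ρ x (loc j))) * Real.exp (-(κ * ρ (loc j) y))
      ≤ m * Kc (κ - κ') * Real.exp (-(κ' * ρ x y)) := by
  calc ∑ j, Real.exp (-(κ * ρ x (loc j))) * Real.exp (-(κ * ρ (loc j) y))
      ≤ ∑ j, Real.exp (-(κ' * ρ x y)) * Real.exp (-((κ - κ') * ρ x (loc j))) :=
        Finset.sum_le_sum fun j _ => exp_mul_exp_le_split (hρ.tri x (loc j) y) (hρ.nonneg _ _) hκ' hlt.le
    _ = Real.exp (-(κ' * ρ x y)) * ∑ j, Real.exp (-((κ - κ') * ρ x (loc j))) := by rw [Finset.mul_sum]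
    _ ≤ Real.exp (-(κ' * ρ x y)) * (m * Kc (κ - κ')) :=
        mul_le_mul_of_nonneg_left (sum_exp_neg_loc_le_pt hKc (sub_pos.2 hlt) loc hfib x) (Real.exp_pos _).le
    _ = m * Kc (κ - κ') * Real.exp (-(κ' * ρ x y)) := by ring

/-- **Entries of a product of two located, exponentially bounded kernels** (rectangular, complex or real): if
`‖P(i,j)‖ ≤ θ_P e^{−κρ(loc i, loc j)}` and `‖Q(j,k)‖ ≤ θ_Q e^{−κρ(loc j, loc k)}` with the middle index set located with
`≤ m` indices per site, then for `0 ≤ κ′ < κ`:  `‖(PQ)(i,k)‖ ≤ θ_Pθ_Q·m·Kc(κ − κ′)·e^{−κ′ρ(loc i, loc k)}`. [folklore]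
[cite: Balaban1988RG2Cluster, (2.16) p.16] -/
theorem entry_mul_le (hρ : WeightHyp 0 ρ)
    (hKc : ∀ b : ℝ, 0 < b → ∀ (T : Finset S) (x : S), ∑ y ∈ T, Real.exp (-(b * ρ x y)) ≤ Kc b)
    {P : Matrix p n 𝕜} {Q : Matrix n q 𝕜} {θP θQ κ κ' : ℝ} (hθP : 0 ≤ θP) (hθQ : 0 ≤ θQ) (hκ' : 0 ≤ κ')
    (hlt : κ' < κ) (locp : p → S) (locn : n → S) (locq : q → S) {m : ℕ}
    (hfib : ∀ x : S, (Finset.univ.filter fun j => locn j = x).card ≤ m)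
    (hP : ∀ i j, ‖P i j‖ ≤ θP * Real.exp (-(κ * ρ (locp i) (locn j))))
    (hQ : ∀ j k, ‖Q j k‖ ≤ θQ * Real.exp (-(κ * ρ (locn j) (locq k)))) (i : p) (k : q) :
    ‖(P * Q) i k‖ ≤ θP * θQ * (m * Kc (κ - κ')) * Real.exp (-(κ' * ρ (locp i) (locq k))) := by
  rw [Matrix.mul_apply]
  calc ‖∑ j, P i j * Q j k‖ ≤ ∑ j, ‖P i j‖ * ‖Q j k‖ :=
        (norm_sum_le _ _).trans (Finset.sum_le_sum fun j _ => norm_mul_le _ _)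
    _ ≤ ∑ j, (θP * Real.exp (-(κ * ρ (locp i) (locn j)))) * (θQ * Real.exp (-(κ * ρ (locn j) (locq k)))) :=
        Finset.sum_le_sum fun j _ => mul_le_mul (hP i j) (hQ j k) (norm_nonneg _)
          (mul_nonneg hθP (Real.exp_pos _).le)
    _ = θP * θQ * ∑ j, Real.exp (-(κ * ρ (locp i) (locn j))) * Real.exp (-(κ * ρ (locn j) (locq k))) := by
        rw [Finset.mul_sum]
        exact Finset.sum_congr rfl fun j _ => by ring
    _ ≤ θP * θQ * (m * Kc (κ - κ') * Real.exp (-(κ' * ρ (locp i) (locq k)))) :=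
        mul_le_mul_of_nonneg_left (conv_exp_le hρ hKc locn hfib hκ' hlt (locp i) (locq k)) (mul_nonneg hθP hθQ)
    _ = θP * θQ * (m * Kc (κ - κ')) * Real.exp (-(κ' * ρ (locp i) (locq k))) := by ring

omit [DecidableEq S] [Fintype n] in
/-- An exponential entrywise bound persists at any smaller rate (`e^{−κd} ≤ e^{−κ′d}` for `κ′ ≤ κ`, `d ≥ 0`).
[folklore] [cite: Balaban1988RG2Cluster, (2.16) p.16] -/
theorem entry_bound_mono_rate (hρ : WeightHyp 0 ρ) {P : Matrix p n 𝕜} {θ κ κ' : ℝ} (hθ : 0 ≤ θ) (hκ : κ' ≤ κ)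
    (locp : p → S) (locn : n → S) (hP : ∀ i j, ‖P i j‖ ≤ θ * Real.exp (-(κ * ρ (locp i) (locn j)))) (i : p)
    (j : n) : ‖P i j‖ ≤ θ * Real.exp (-(κ' * ρ (locp i) (locn j))) :=
  (hP i j).trans (mul_le_mul_of_nonneg_left
    (Real.exp_le_exp.2 (neg_le_neg (mul_le_mul_of_nonneg_right hκ (hρ.nonneg _ _)))) hθ)

omit [DecidableEq S] [Fintype n] in
/-- The transpose of a located kernel obeys the bound with the location maps swapped (the weight is symmetric).
[folklore] [cite: Balaban1988RG2Cluster, (2.16) p.16] -/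
theorem entry_bound_transpose (hρs : ∀ x y : S, ρ x y = ρ y x) {P : Matrix p n 𝕜} {θ κ : ℝ} (locp : p → S)
    (locn : n → S) (hP : ∀ i j, ‖P i j‖ ≤ θ * Real.exp (-(κ * ρ (locp i) (locn j)))) (j : n) (i : p) :
    ‖Pᵀ j i‖ ≤ θ * Real.exp (-(κ * ρ (locn j) (locp i))) := by
  rw [Matrix.transpose_apply, hρs]
  exact hP i j

end Composition

section Bound

variable {S : Type*} [DecidableEq S] {ρ : S → S → ℝ} {Kc : ℝ → ℝ}
variable {Λ N : Type} [Fintype Λ]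

/-- **Entries of a located triple product** `PᵀKQ` (`P, Q : Λ × N`, `K : Λ × Λ`, all complex): if `‖P(b,j)‖ ≤ θ_P·w`,
`‖K(b,b′)‖ ≤ θ_K·w`, `‖Q(b,j)‖ ≤ θ_Q·w` with `w = e^{−κρ(·,·)}` and `Λ` located with `≤ m` per site, then for rates
`κ > κ′ > κ″ ≥ 0`:  `‖(PᵀKQ)(i,l)‖ ≤ θ_Pθ_K·m·Kc(κ−κ′)·θ_Q·m·Kc(κ′−κ″)·e^{−κ″ρ(loc i, loc l)}` (two compositions).
[folklore] [cite: Balaban1988RG2Cluster, (2.16) p.16] -/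
theorem entry_triple_le (hρ : WeightHyp 0 ρ) (hρs : ∀ x y : S, ρ x y = ρ y x)
    (hKc : ∀ b : ℝ, 0 < b → ∀ (T : Finset S) (x : S), ∑ y ∈ T, Real.exp (-(b * ρ x y)) ≤ Kc b)
    (hKc0 : ∀ b : ℝ, 0 < b → 0 ≤ Kc b)
    {P Q : Matrix Λ N ℂ} {K : Matrix Λ Λ ℂ} {θP θK θQ κ κ' κ'' : ℝ} (hθP : 0 ≤ θP) (hθK : 0 ≤ θK)
    (hθQ : 0 ≤ θQ) (hκ'' : 0 ≤ κ'') (h1 : κ'' < κ') (h2 : κ' < κ) (locΛ : Λ → S) (locN : N → S) {m : ℕ}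
    (hfib : ∀ x : S, (Finset.univ.filter fun b => locΛ b = x).card ≤ m)
    (hP : ∀ b j, ‖P b j‖ ≤ θP * Real.exp (-(κ * ρ (locΛ b) (locN j))))
    (hK : ∀ b b', ‖K b b'‖ ≤ θK * Real.exp (-(κ * ρ (locΛ b) (locΛ b'))))
    (hQ : ∀ b j, ‖Q b j‖ ≤ θQ * Real.exp (-(κ * ρ (locΛ b) (locN j)))) (i l : N) :
    ‖(Pᵀ * K * Q) i l‖ ≤ θP * θK * (m * Kc (κ - κ')) * θQ * (m * Kc (κ' - κ''))
      * Real.exp (-(κ'' * ρ (locN i) (locN l))) := by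
  have hκ' : 0 ≤ κ' := hκ''.trans h1.le
  -- first composition: Pᵀ K at rate κ′
  have hPK : ∀ i b', ‖(Pᵀ * K) i b'‖ ≤ θP * θK * (m * Kc (κ - κ')) * Real.exp (-(κ' * ρ (locN i) (locΛ b'))) :=
    entry_mul_le hρ hKc hθP hθK hκ' h2 locN locΛ locΛ hfib (entry_bound_transpose hρs locΛ locN hP) hK
  -- second composition: (PᵀK) Q at rate κ″, Q weakened to rate κ′
  have hQ' : ∀ b j, ‖Q b j‖ ≤ θQ * Real.exp (-(κ' * ρ (locΛ b) (locN j))) :=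
    entry_bound_mono_rate hρ hθQ h2.le locΛ locN hQ
  exact entry_mul_le hρ hKc (mul_nonneg (mul_nonneg hθP hθK)
    (mul_nonneg (Nat.cast_nonneg m) (hKc0 _ (sub_pos.2 h2)))) hθQ hκ'' h1 locN locΛ locN hfib hPK hQ' i l

/-- **(2.16) for `R₁` from the primitive kernels** (*"with matrix elements satisfying the bound (2.16)"*).  Let
`R₁ = Γ₀ᵀCΓ₀ − Re(GᵀC_σG)` (`B13Eq216FirstForm.hdef1_of_linear`).  Suppose, on bonds located in `S` (`Λ` with `≤ m` per
site), at rate `κ`: the two DIFFERENCE kernels obey the entrywise (2.16) — `‖(G − Γ₀)(b,j)‖ ≤ θ_Γ e^{−κρ}`,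
`‖(C_σ − C)(b,b′)‖ ≤ θ_C e^{−κρ}` (the leaf for the primitive objects of [13]/[15]) — and the kernels themselves are
uniformly localised — `‖G‖ ≤ K_G e^{−κρ}`, `‖Γ₀‖ ≤ K_Γ e^{−κρ}`, `‖C_σ‖ ≤ K_{Cσ} e^{−κρ}`, `‖C‖ ≤ K₀ e^{−κρ}` (L17a).  Then
for rates `κ > κ′ > κ″ ≥ 0`, with `Lc = m·Kc(κ−κ′)·m·Kc(κ′−κ″)`:
`|R₁(i, l)| ≤ Lc·(θ_Γ K_{Cσ} K_G + K_Γ θ_C K_G + K_Γ K₀ θ_Γ)·e^{−κ″ρ(loc i, loc l)}`. [cite: Balaban1988RG2Cluster, (2.16) p.16] -/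
theorem h216R1_of_factors (hρ : WeightHyp 0 ρ) (hρs : ∀ x y : S, ρ x y = ρ y x)
    (hKc : ∀ b : ℝ, 0 < b → ∀ (T : Finset S) (x : S), ∑ y ∈ T, Real.exp (-(b * ρ x y)) ≤ Kc b)
    (hKc0 : ∀ b : ℝ, 0 < b → 0 ≤ Kc b)
    {G : Matrix Λ N ℂ} {Γ₀ : Matrix Λ N ℝ} {Cs : Matrix Λ Λ ℂ} {C : Matrix Λ Λ ℝ}
    {θΓ θC KG KΓ KCs K₀ κ κ' κ'' : ℝ} (hθΓ : 0 ≤ θΓ) (hθC : 0 ≤ θC) (hKG : 0 ≤ KG) (hKΓ : 0 ≤ KΓ)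
    (hKCs : 0 ≤ KCs) (hK₀ : 0 ≤ K₀) (hκ'' : 0 ≤ κ'') (h1 : κ'' < κ') (h2 : κ' < κ)
    (locΛ : Λ → S) (locN : N → S) {m : ℕ} (hfib : ∀ x : S, (Finset.univ.filter fun b => locΛ b = x).card ≤ m)
    (hdΓ : ∀ b j, ‖(G - Γ₀.map (algebraMap ℝ ℂ)) b j‖ ≤ θΓ * Real.exp (-(κ * ρ (locΛ b) (locN j))))
    (hdC : ∀ b b', ‖(Cs - C.map (algebraMap ℝ ℂ)) b b'‖ ≤ θC * Real.exp (-(κ * ρ (locΛ b) (locΛ b'))))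
    (hG : ∀ b j, ‖G b j‖ ≤ KG * Real.exp (-(κ * ρ (locΛ b) (locN j))))
    (hΓ₀ : ∀ b j, ‖Γ₀ b j‖ ≤ KΓ * Real.exp (-(κ * ρ (locΛ b) (locN j))))
    (hCs : ∀ b b', ‖Cs b b'‖ ≤ KCs * Real.exp (-(κ * ρ (locΛ b) (locΛ b'))))
    (hC : ∀ b b', ‖C b b'‖ ≤ K₀ * Real.exp (-(κ * ρ (locΛ b) (locΛ b')))) (i l : N) :
    ‖(Γ₀ᵀ * C * Γ₀ - (Gᵀ * Cs * G).map Complex.re) i l‖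
      ≤ (m * Kc (κ - κ')) * (m * Kc (κ' - κ''))
          * (θΓ * KCs * KG + KΓ * θC * KG + KΓ * K₀ * θΓ) * Real.exp (-(κ'' * ρ (locN i) (locN l))) := by
  set Γc : Matrix Λ N ℂ := Γ₀.map (algebraMap ℝ ℂ) with hΓc
  set Cc : Matrix Λ Λ ℂ := C.map (algebraMap ℝ ℂ) with hCc
  set L1 : ℝ := m * Kc (κ - κ') with hL1
  set L2 : ℝ := m * Kc (κ' - κ'') with hL2
  set w : ℝ := Real.exp (-(κ'' * ρ (locN i) (locN l))) with hw
  -- the real kernel is the real part of the complex difference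
  have hreal : (Γ₀ᵀ * C * Γ₀ - (Gᵀ * Cs * G).map Complex.re) i l
      = -((Gᵀ * Cs * G - Γcᵀ * Cc * Γc) i l).re := by
    have e1 : (Γcᵀ * Cc * Γc) = (Γ₀ᵀ * C * Γ₀).map (algebraMap ℝ ℂ) := by
      rw [hΓc, hCc, ← Matrix.transpose_map, ← Matrix.map_mul, ← Matrix.map_mul]
    rw [Matrix.sub_apply, Matrix.map_apply, Matrix.sub_apply, e1, Matrix.map_apply, Complex.sub_re,
      Complex.coe_algebraMap, Complex.ofReal_re]
    ring
  rw [hreal, norm_neg, Real.norm_eq_abs]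
  refine (Complex.abs_re_le_norm _).trans ?_
  rw [triple_sub_triple G Γc Cs Cc, Matrix.add_apply, Matrix.add_apply]
  -- the three located triple products
  have hΓc' : ∀ b j, ‖Γc b j‖ ≤ KΓ * Real.exp (-(κ * ρ (locΛ b) (locN j))) := entry_bound_map_ofReal hΓ₀
  have hCc' : ∀ b b', ‖Cc b b'‖ ≤ K₀ * Real.exp (-(κ * ρ (locΛ b) (locΛ b'))) := entry_bound_map_ofReal hC
  have t1 := entry_triple_le (P := G - Γc) (K := Cs) (Q := G) hρ hρs hKc hKc0 hθΓ hKCs hKG hκ'' h1 h2 locΛ locN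
    hfib hdΓ hCs hG i l
  have t2 := entry_triple_le (P := Γc) (K := Cs - Cc) (Q := G) hρ hρs hKc hKc0 hKΓ hθC hKG hκ'' h1 h2 locΛ locN
    hfib hΓc' hdC hG i l
  have t3 := entry_triple_le (P := Γc) (K := Cc) (Q := G - Γc) hρ hρs hKc hKc0 hKΓ hK₀ hθΓ hκ'' h1 h2 locΛ locN
    hfib hΓc' hCc' hdΓ i l
  rw [← hL1, ← hL2, ← hw] at t1 t2 t3
  calc ‖((G - Γc)ᵀ * Cs * G) i l + (Γcᵀ * (Cs - Cc) * G) i l + (Γcᵀ * Cc * (G - Γc)) i l‖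
      ≤ ‖((G - Γc)ᵀ * Cs * G) i l‖ + ‖(Γcᵀ * (Cs - Cc) * G) i l‖ + ‖(Γcᵀ * Cc * (G - Γc)) i l‖ :=
        norm_add₃_le
    _ ≤ θΓ * KCs * L1 * KG * L2 * w + KΓ * θC * L1 * KG * L2 * w + KΓ * K₀ * L1 * θΓ * L2 * w :=
        add_le_add (add_le_add t1 t2) t3
    _ = L1 * L2 * (θΓ * KCs * KG + KΓ * θC * KG + KΓ * K₀ * θΓ) * w := by ring

end Bound

/-! ## §3. The hypotheses `hR1`, `hR2`, `hR3`, `h17a`, `h17b` from the entrywise (2.16) -/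

section From216

variable {S : Type*} [DecidableEq S] {ρ : S → S → ℝ} {Kc : ℝ → ℝ}
variable {Λ N : Type} [Fintype Λ] [Fintype N] [DecidableEq Λ] [DecidableEq N]
variable {A : Matrix Λ Λ ℂ} {C : Matrix Λ Λ ℝ}

omit [DecidableEq N] in
/-- **`hR1` from (2.16) for `R₁`** (*"For the quadratic form in the first exponential the difference is a quadratic form
½⟨X, R₁X⟩, with matrix elements satisfying the bound (2.16)"*): if `Re⟨Γ_σX, A⁻¹Γ_σX⟩ = ⟨Γ₀X, CΓ₀X⟩ − ⟨X, R₁X⟩` with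
`|R₁(b,b′)| ≤ θe^{−κρ(b₋,b′₋)}` (`κ > 0`, bonds located in `S` with `≤ m` per site), then
`−½Re⟨Γ_σX, A⁻¹Γ_σX⟩ ≤ −½⟨Γ₀X, CΓ₀X⟩ + ½θ′‖X‖²`, `θ′ = θ·m·Kc(κ)` — (2.21) for `R₁` by Schur
(`B13Replacement223.hR1_of_WRS`). [cite: Balaban1988RG2Cluster, (2.16) p.16, (2.21) p.16] -/
theorem hR1_of_entrywise (hρ : WeightHyp 0 ρ) (hρs : ∀ x y : S, ρ x y = ρ y x)
    (hKc : ∀ b : ℝ, 0 < b → ∀ (T : Finset S) (x : S), ∑ y ∈ T, Real.exp (-(b * ρ x y)) ≤ Kc b)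
    (Γσ : (N → ℝ) → (Λ → ℂ)) (Γ₀ : Matrix Λ N ℝ) (R₁ : Matrix N N ℝ) {θ κ : ℝ} (hθ : 0 ≤ θ) (hκ : 0 < κ)
    (loc : N → S) {m : ℕ} (hfib : ∀ x : S, (Finset.univ.filter fun j => loc j = x).card ≤ m)
    (hdef : ∀ X : N → ℝ, ((Γσ X) ⬝ᵥ (A⁻¹ *ᵥ Γσ X)).re = (Γ₀ *ᵥ X) ⬝ᵥ (C *ᵥ (Γ₀ *ᵥ X)) - X ⬝ᵥ (R₁ *ᵥ X))
    (h216 : ∀ b b', ‖R₁ b b'‖ ≤ θ * Real.exp (-(κ * ρ (loc b) (loc b')))) (X : N → ℝ) :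
    -(1 / 2) * ((Γσ X) ⬝ᵥ (A⁻¹ *ᵥ Γσ X)).re
      ≤ -(1 / 2 * ((Γ₀ *ᵥ X) ⬝ᵥ (C *ᵥ (Γ₀ *ᵥ X)))) + θ * (m * Kc κ) / 2 * (X ⬝ᵥ X) := by
  obtain ⟨h1, h1t⟩ := WRS_zero_of_entrywise hKc hρs hθ hκ loc hfib h216
  exact hR1_of_WRS (weightHyp_loc hρ le_rfl loc) Γσ Γ₀ R₁ hdef h1 h1t X

omit [Fintype Λ] [DecidableEq Λ] in
/-- A complex entrywise bound passes to the real part and to its negative; private plumbing. [folklore] -/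
private theorem entrywise_re_neg {E : Matrix Λ Λ ℂ} {g : Λ → Λ → ℝ} (hE : ∀ i j, ‖E i j‖ ≤ g i j) :
    ∀ i j, ‖(-(E.map Complex.re)) i j‖ ≤ g i j := fun i j => by
  rw [Matrix.neg_apply, norm_neg, Matrix.map_apply, Real.norm_eq_abs]
  exact (Complex.abs_re_le_norm _).trans (hE i j)

/-- **`hR2` from (2.16) for `R₂`** (*"the next Gaussian measure is replaced by the measure with the new covariance …
and by the function exp½⟨B, R₂B⟩ with R₂ satisfying (2.16)"*): with `E = A − C⁻¹` (`R₂ = C⁻¹ − Re A = −Re E`), an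
entrywise bound `‖E(b,b′)‖ ≤ θe^{−κρ(b₋,b′₋)}` gives `⟨B, R₂B⟩ ≤ θ′‖B‖²`, `θ′ = θ·m·Kc(κ)`. [cite: Balaban1988RG2Cluster, (2.16) p.16, (2.21) p.16] -/
theorem hR2_of_entrywise (hρ : WeightHyp 0 ρ) (hρs : ∀ x y : S, ρ x y = ρ y x)
    (hKc : ∀ b : ℝ, 0 < b → ∀ (T : Finset S) (x : S), ∑ y ∈ T, Real.exp (-(b * ρ x y)) ≤ Kc b)
    {θ κ : ℝ} (hθ : 0 ≤ θ) (hκ : 0 < κ) (loc : Λ → S) {m : ℕ}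
    (hfib : ∀ x : S, (Finset.univ.filter fun j => loc j = x).card ≤ m)
    (hE : ∀ b b', ‖(A - C⁻¹.map (algebraMap ℝ ℂ)) b b'‖ ≤ θ * Real.exp (-(κ * ρ (loc b) (loc b')))) (B : Λ → ℝ) :
    B ⬝ᵥ ((C⁻¹ - A.map Complex.re) *ᵥ B) ≤ θ * (m * Kc κ) * (B ⬝ᵥ B) := by
  have hRe : C⁻¹ - A.map Complex.re = -((A - C⁻¹.map (algebraMap ℝ ℂ)).map Complex.re) := by
    ext i j
    simp only [Matrix.sub_apply, Matrix.neg_apply, Matrix.map_apply, Complex.sub_re, Complex.coe_algebraMap,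
      Complex.ofReal_re]
    ring
  obtain ⟨h2, h2t⟩ := WRS_zero_of_entrywise hKc hρs hθ hκ loc hfib (entrywise_re_neg hE)
  rw [← hRe] at h2 h2t
  exact hR2_of_WRS (weightHyp_loc hρ le_rfl loc) h2 h2t B

omit [DecidableEq Λ] [DecidableEq N] in
/-- **`hR3` from (2.16) for `R₃`** (*"In the second exponential the difference between the new bilinear form and the form
in (2.15) is a bilinear form −⟨B, R₃X⟩ with R₃ satisfying (2.16)"*): if `Re Γ_σX = (Γ₀ + R₃)X` with the RECTANGULAR
kernel `|R₃(b,b′)| ≤ θe^{−κρ(b₋,b′₋)}` (rows = bonds of `Z₀`, columns = bonds of `Z`, both located in `S` with `≤ m` per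
site), then `−⟨B, Re Γ_σX⟩ ≤ −⟨B, Γ₀X⟩ + ½θ′(‖X‖² + ‖B‖²)`, `θ′ = θ·m·Kc(κ)` — (2.21) for `R₃`
(`B13Replacement223.hR3_of_rowSum` + §1). [cite: Balaban1988RG2Cluster, (2.16) p.16, (2.21) p.16] -/
theorem hR3_of_entrywise (hρs : ∀ x y : S, ρ x y = ρ y x)
    (hKc : ∀ b : ℝ, 0 < b → ∀ (T : Finset S) (x : S), ∑ y ∈ T, Real.exp (-(b * ρ x y)) ≤ Kc b)
    (Γσ : (N → ℝ) → (Λ → ℂ)) (Γ₀ R₃ : Matrix Λ N ℝ) {θ κ : ℝ} (hθ : 0 ≤ θ) (hκ : 0 < κ)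
    (locΛ : Λ → S) (locN : N → S) {m : ℕ}
    (hfibΛ : ∀ x : S, (Finset.univ.filter fun i => locΛ i = x).card ≤ m)
    (hfibN : ∀ x : S, (Finset.univ.filter fun j => locN j = x).card ≤ m)
    (hdef : ∀ (X : N → ℝ) (i : Λ), (Γσ X i).re = ((Γ₀ + R₃) *ᵥ X) i)
    (h216 : ∀ i j, ‖R₃ i j‖ ≤ θ * Real.exp (-(κ * ρ (locΛ i) (locN j)))) (X : N → ℝ) (B : Λ → ℝ) :
    -(B ⬝ᵥ fun i => (Γσ X i).re) ≤ -(B ⬝ᵥ (Γ₀ *ᵥ X)) + θ * (m * Kc κ) / 2 * (X ⬝ᵥ X + B ⬝ᵥ B) := by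
  have hr : ∀ i, ∑ j, |R₃ i j| ≤ θ * (m * Kc κ) := fun i => by
    simpa only [Real.norm_eq_abs] using rowSum_norm_le_of_entrywise hKc hθ hκ locΛ locN hfibN h216 i
  have hc : ∀ j, ∑ i, |R₃ i j| ≤ θ * (m * Kc κ) := fun j => by
    simpa only [Real.norm_eq_abs] using colSum_norm_le_of_entrywise hKc hρs hθ hκ locΛ locN hfibΛ h216 j
  exact hR3_of_rowSum Γσ Γ₀ R₃ hdef hr hc X B

/-- **The (2.17) factor of (2.15) from entrywise bounds** (*"The determinants in the next factor are equal for the new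
operators, hence this factor can be estimated by (2.17)"*): if the new covariance `C = C^{(k)}(Z₀, 0)` has the
entrywise decay `|C(b,b′)| ≤ K₀e^{−κ_Cρ(b₋,b′₋)}` (the [15] propagator bound) and `E = A − C⁻¹` obeys (2.16) with
`(θ, κ)`, and `K′θ′ < 1` (`K′ = K₀·m·Kc(κ_C)`, `θ′ = θ·m·Kc(κ)`), then `|det A/det Re A|^{1/2} ≤ exp(η|Λ|)`,
`η = ½K′θ′(1 + (1 − K′θ′)⁻¹)` (`B13Replacement223.h17a_of_WRS`). [cite: Balaban1988RG2Cluster, (2.16)–(2.17) p.16] -/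
theorem h17a_of_entrywise (hρ : WeightHyp 0 ρ) (hρs : ∀ x y : S, ρ x y = ρ y x)
    (hKc : ∀ b : ℝ, 0 < b → ∀ (T : Finset S) (x : S), ∑ y ∈ T, Real.exp (-(b * ρ x y)) ≤ Kc b)
    (hC : C.PosDef) (hA : (A.map Complex.re).PosDef) {θ κ K₀ κC : ℝ} (hθ : 0 ≤ θ) (hκ : 0 < κ) (hK₀ : 0 ≤ K₀)
    (hκC : 0 < κC) (loc : Λ → S) {m : ℕ} (hfib : ∀ x : S, (Finset.univ.filter fun j => loc j = x).card ≤ m)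
    (hC216 : ∀ b b', ‖C b b'‖ ≤ K₀ * Real.exp (-(κC * ρ (loc b) (loc b'))))
    (hE : ∀ b b', ‖(A - C⁻¹.map (algebraMap ℝ ℂ)) b b'‖ ≤ θ * Real.exp (-(κ * ρ (loc b) (loc b'))))
    (hsmall : K₀ * (m * Kc κC) * (θ * (m * Kc κ)) < 1) :
    Real.sqrt (‖A.det‖ / (A.map Complex.re).det)
      ≤ Real.exp (K₀ * (m * Kc κC) * (θ * (m * Kc κ)) * (1 + (1 - K₀ * (m * Kc κC) * (θ * (m * Kc κ)))⁻¹) / 2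
          * Fintype.card Λ) :=
  h17a_of_WRS (weightHyp_loc hρ le_rfl loc) hC hA (WRS_zero_of_entrywise hKc hρs hK₀ hκC loc hfib hC216).1
    (WRS_zero_of_entrywise hKc hρs hθ hκ loc hfib hE).1 hsmall

/-- **The quotient of determinants of the measure change from entrywise bounds** (*"a quotient of determinants, which
can be estimated by (2.17)"*): under the hypotheses of `h17a_of_entrywise`,
`√(det Re A/det C⁻¹) ≤ exp(½K′θ′·|Λ|) ≤ exp(η|Λ|)` with the same `η` (`B13Replacement223.h17b_of_WRS`; `Re E` inherits
the entrywise bound). [cite: Balaban1988RG2Cluster, (2.17) p.16] -/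
theorem h17b_of_entrywise (hρ : WeightHyp 0 ρ) (hρs : ∀ x y : S, ρ x y = ρ y x)
    (hKc : ∀ b : ℝ, 0 < b → ∀ (T : Finset S) (x : S), ∑ y ∈ T, Real.exp (-(b * ρ x y)) ≤ Kc b)
    (hC : C.PosDef) (hA : (A.map Complex.re).PosDef) {θ κ K₀ κC : ℝ} (hθ : 0 ≤ θ) (hκ : 0 < κ) (hK₀ : 0 ≤ K₀)
    (hκC : 0 < κC) (loc : Λ → S) {m : ℕ} (hfib : ∀ x : S, (Finset.univ.filter fun j => loc j = x).card ≤ m)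
    (hC216 : ∀ b b', ‖C b b'‖ ≤ K₀ * Real.exp (-(κC * ρ (loc b) (loc b'))))
    (hE : ∀ b b', ‖(A - C⁻¹.map (algebraMap ℝ ℂ)) b b'‖ ≤ θ * Real.exp (-(κ * ρ (loc b) (loc b'))))
    (hsmall : K₀ * (m * Kc κC) * (θ * (m * Kc κ)) < 1) :
    Real.sqrt ((A.map Complex.re).det / C⁻¹.det)
      ≤ Real.exp (K₀ * (m * Kc κC) * (θ * (m * Kc κ)) * (1 + (1 - K₀ * (m * Kc κC) * (θ * (m * Kc κ)))⁻¹) / 2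
          * Fintype.card Λ) := by
  have hRe : (A - C⁻¹.map (algebraMap ℝ ℂ)).map Complex.re = A.map Complex.re - C⁻¹ := by
    ext i j
    simp only [Matrix.sub_apply, Matrix.map_apply, Complex.sub_re, Complex.coe_algebraMap, Complex.ofReal_re]
  have hE' : ∀ b b', ‖(A.map Complex.re - C⁻¹) b b'‖ ≤ θ * Real.exp (-(κ * ρ (loc b) (loc b'))) :=
    fun b b' => by
      rw [← hRe, Matrix.map_apply, Real.norm_eq_abs]
      exact (Complex.abs_re_le_norm _).trans (hE b b')
  set K' : ℝ := K₀ * (m * Kc κC) with hK'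
  set θ' : ℝ := θ * (m * Kc κ) with hθ'
  have h := h17b_of_WRS (weightHyp_loc hρ le_rfl loc) hC hA (WRS_zero_of_entrywise hKc hρs hK₀ hκC loc hfib hC216).1
    (WRS_zero_of_entrywise hKc hρs hθ hκ loc hfib hE').1 hsmall
  refine h.trans (Real.exp_le_exp.2 ?_)
  rcases isEmpty_or_nonempty Λ with hΛ | ⟨⟨i₀⟩⟩
  · simp
  have hKθ0 : 0 ≤ K' * θ' :=
    mul_nonneg (mul_nonneg hK₀ (mul_nonneg (Nat.cast_nonneg m) (Kc_nonneg hKc hκC (loc i₀))))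
      (mul_nonneg hθ (mul_nonneg (Nat.cast_nonneg m) (Kc_nonneg hKc hκ (loc i₀))))
  have hinv : 0 ≤ (1 - K' * θ')⁻¹ := inv_nonneg.2 (by linarith)
  refine mul_le_mul_of_nonneg_right ?_ (Nat.cast_nonneg _)
  rw [← hK', ← hθ'] at *
  nlinarith [mul_nonneg hKθ0 hinv]

end From216

/-! ## §4. (2.26) assembled with (2.16) entrywise -/

section Assembly

variable {S : Type*} [DecidableEq S] {ρ : S → S → ℝ} {Kc : ℝ → ℝ}
variable {Λ : Type} [Fintype Λ] [DecidableEq Λ] {C₀ : Type} [Fintype C₀] [DecidableEq C₀]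
variable {ι κ : Type*}

/-- **The sup bound `K` of the last three lines of (2.14), with (2.16) ENTRYWISE** — `B13Bound226Assembly.norm_core214_F214_le_K`
with its five replacement hypotheses `hR1`, `hR2`, `hR3`, `h17a`, `h17b` replaced by: uniformly for the `σ` of the
σ-polydisc, the identities defining `R₁(σ)` and `R₃(σ)`, the entrywise (2.16) for `R₁(σ)`, `E(σ) = A(σ) − C⁻¹`, `R₃(σ)`
with `(θ, κ)`; the entrywise decay `(K₀, κ_C)` of `C`; bonds of `Z₀` (`Λ`) and of `Z` (`Λ ⊕ C₀`) located in `S` with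
`≤ m` per site; `K′θ′ < 1`.  Conclusion: on the polydiscs
`‖∫dμ₀(X)|_Z (lines 2–4 of (2.14))(σ, τ)‖ ≤ e^{2η|Λ|}·exp(−½γ₂(ε₁²/g_k²)|P| + w)·e^{α₅c|Λ|}·e^{α₅(1+2cg)|N|}` with
`α₅ = 2θ′ + γ₂ + a`, `θ′ = θ·m·Kc(κ)`, `η = ½K′θ′(1 + (1 − K′θ′)⁻¹)`, `K′ = K₀·m·Kc(κ_C)`.
[cite: Balaban1988RG2Cluster, (2.15) p.15, (2.16)–(2.22) p.16, (2.23)–(2.26) p.17] -/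
theorem norm_core214_F214_le_K_of_216 (hρ : WeightHyp 0 ρ) (hρs : ∀ x y : S, ρ x y = ρ y x)
    (hKc : ∀ b : ℝ, 0 < b → ∀ (T : Finset S) (x : S), ∑ y ∈ T, Real.exp (-(b * ρ x y)) ≤ Kc b)
    (hKc0 : ∀ b : ℝ, 0 < b → 0 ≤ Kc b)
    (A : (ι → ℂ) → Matrix Λ Λ ℂ) (Γ : (ι → ℂ) → (Λ ⊕ C₀ → ℝ) → (Λ → ℂ))
    {C : Matrix Λ Λ ℝ} (hC : C.PosDef) (Γ₀ : Matrix Λ (Λ ⊕ C₀) ℝ) (Rσ : ι → ℝ) (Rτ : κ → ℝ)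
    (hAs : ∀ σ : ι → ℂ, (∀ j, ‖σ j‖ ≤ Rσ j) → (A σ).IsSymm)
    (hA : ∀ σ : ι → ℂ, (∀ j, ‖σ j‖ ≤ Rσ j) → ((A σ).map Complex.re).PosDef)
    (hΓc : ∀ σ : ι → ℂ, (∀ j, ‖σ j‖ ≤ Rσ j) → Continuous (Γ σ))
    (cardP : ℕ) (χY₀ χcP : (Λ → ℝ) → ℝ) (hχ0 : ∀ B, 0 ≤ χY₀ B) (hχc0 : ∀ B, 0 ≤ χcP B) (Dfam : Finset κ)
    (V : κ → (Λ → ℝ) → ℂ) {γ₂ r a w : ℝ} (qP : (Λ → ℝ) → ℝ)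
    (h222 : ∀ B, χY₀ B * χcP B ≤ Real.exp (-(γ₂ / 2 * r ^ 2 * cardP) + γ₂ / 2 * qP B)) (hγ₂ : 0 ≤ γ₂)
    (hqP : ∀ B, qP B ≤ B ⬝ᵥ B) (h220R : ∀ B, ∑ Y ∈ Dfam, Rτ Y * ‖V Y B‖ ≤ a / 2 * (B ⬝ᵥ B) + w) (ha0 : 0 ≤ a)
    -- the located bonds and the entrywise (2.16)
    {θ kap K₀ κC : ℝ} (hθ : 0 ≤ θ) (hkap : 0 < kap) (hK₀ : 0 ≤ K₀) (hκC : 0 < κC)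
    (locΛ : Λ → S) (locN : Λ ⊕ C₀ → S) {m : ℕ}
    (hfibΛ : ∀ x : S, (Finset.univ.filter fun i => locΛ i = x).card ≤ m)
    (hfibN : ∀ x : S, (Finset.univ.filter fun j => locN j = x).card ≤ m)
    (R₁ : (ι → ℂ) → Matrix (Λ ⊕ C₀) (Λ ⊕ C₀) ℝ) (R₃ : (ι → ℂ) → Matrix Λ (Λ ⊕ C₀) ℝ)
    (hdef1 : ∀ σ : ι → ℂ, (∀ j, ‖σ j‖ ≤ Rσ j) → ∀ X : Λ ⊕ C₀ → ℝ,
      ((Γ σ X) ⬝ᵥ ((A σ)⁻¹ *ᵥ Γ σ X)).re = (Γ₀ *ᵥ X) ⬝ᵥ (C *ᵥ (Γ₀ *ᵥ X)) - X ⬝ᵥ (R₁ σ *ᵥ X))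
    (h216R1 : ∀ σ : ι → ℂ, (∀ j, ‖σ j‖ ≤ Rσ j) →
      ∀ b b', ‖R₁ σ b b'‖ ≤ θ * Real.exp (-(kap * ρ (locN b) (locN b'))))
    (h216E : ∀ σ : ι → ℂ, (∀ j, ‖σ j‖ ≤ Rσ j) →
      ∀ b b', ‖(A σ - C⁻¹.map (algebraMap ℝ ℂ)) b b'‖ ≤ θ * Real.exp (-(kap * ρ (locΛ b) (locΛ b'))))
    (hdef3 : ∀ σ : ι → ℂ, (∀ j, ‖σ j‖ ≤ Rσ j) → ∀ (X : Λ ⊕ C₀ → ℝ) (i : Λ), (Γ σ X i).re = ((Γ₀ + R₃ σ) *ᵥ X) i)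
    (h216R3 : ∀ σ : ι → ℂ, (∀ j, ‖σ j‖ ≤ Rσ j) →
      ∀ i j, ‖R₃ σ i j‖ ≤ θ * Real.exp (-(kap * ρ (locΛ i) (locN j))))
    (hC216 : ∀ b b', ‖C b b'‖ ≤ K₀ * Real.exp (-(κC * ρ (locΛ b) (locΛ b'))))
    (hsmallKθ : K₀ * (m * Kc κC) * (θ * (m * Kc kap)) < 1)
    -- the (2.24)–(2.25) smallness
    {c g : ℝ} (hc0 : 0 ≤ c) (hc : ∀ k, hC.1.eigenvalues k ≤ c)
    (hαc : (2 * (θ * (m * Kc kap)) + (γ₂ + a)) * c ≤ 1 / 2) (hg : 0 ≤ g)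
    (hΓ : ∀ X : Λ ⊕ C₀ → ℝ, (Γ₀ *ᵥ X) ⬝ᵥ (C *ᵥ (Γ₀ *ᵥ X)) ≤ g * (X ⬝ᵥ X))
    (hsmall : (2 * (θ * (m * Kc kap)) + (γ₂ + a)) * (1 + 2 * c * g) ≤ 1 / 2) :
    ∀ (σ : ι → ℂ) (τ : κ → ℂ), (∀ j, ‖σ j‖ ≤ Rσ j) → (∀ Y, ‖τ Y‖ ≤ Rτ Y) →
      ‖core214 A Γ (F214 cardP χY₀ χcP Dfam V) σ τ‖
        ≤ Real.exp (2 * (K₀ * (m * Kc κC) * (θ * (m * Kc kap))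
              * (1 + (1 - K₀ * (m * Kc κC) * (θ * (m * Kc kap)))⁻¹) / 2) * Fintype.card Λ)
          * Real.exp (-(γ₂ / 2 * r ^ 2 * cardP) + w)
          * (Real.exp ((2 * (θ * (m * Kc kap)) + (γ₂ + a)) * c * Fintype.card Λ)
            * Real.exp ((2 * (θ * (m * Kc kap)) + (γ₂ + a)) * (1 + 2 * c * g) * Fintype.card (Λ ⊕ C₀))) :=
  norm_core214_F214_le_K A Γ hC Γ₀ Rσ Rτ hAs hA hΓc cardP χY₀ χcP hχ0 hχc0 Dfam V qP h222 hγ₂ hqP h220R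
    (ρ := θ * (m * Kc kap)) (mul_nonneg hθ (mul_nonneg (Nat.cast_nonneg m) (hKc0 _ hkap))) ha0
    (fun σ hσ X => hR1_of_entrywise hρ hρs hKc (Γ σ) Γ₀ (R₁ σ) hθ hkap locN hfibN (hdef1 σ hσ) (h216R1 σ hσ) X)
    (fun σ hσ => h17a_of_entrywise hρ hρs hKc hC (hA σ hσ) hθ hkap hK₀ hκC locΛ hfibΛ hC216 (h216E σ hσ) hsmallKθ)
    (fun σ hσ => h17b_of_entrywise hρ hρs hKc hC (hA σ hσ) hθ hkap hK₀ hκC locΛ hfibΛ hC216 (h216E σ hσ) hsmallKθ)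
    (fun σ hσ B => hR2_of_entrywise hρ hρs hKc hθ hkap locΛ hfibΛ (h216E σ hσ) B)
    (fun σ hσ X B => hR3_of_entrywise hρs hKc (Γ σ) Γ₀ (R₃ σ) hθ hkap locΛ locN hfibΛ hfibN (hdef3 σ hσ)
      (h216R3 σ hσ) X B)
    hc0 hc hαc hg hΓ hsmall

variable [DecidableEq ι] [DecidableEq κ]

/-- **(2.26) assembled end to end for the typed term (2.14), with (2.16) ENTRYWISE** (*"Gathering together all the
bounds we get"* (2.26)): σ-radius `e^{κ₁}` (`κ₁ ≥ 1`), τ-radii `R_τ(Y) ≥ 2`, separate analyticity in (σ, τ), base points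
in the unit polydiscs — with the replacement errors entered as the printed entrywise (2.16) for `R₁(σ)`,
`E(σ) = A(σ) − C⁻¹`, `R₃(σ)` uniformly on the σ-polydisc, the entrywise decay of `C`, bonds located in `S`, and
`K′θ′ < 1`:  `|(2.14)| ≤ exp(−(κ₁ − 1)|lZ|) · [Π_{Y∈𝐃} 2/R_τ(Y)] · e^{2η|Λ|} · exp(−½γ₂(ε₁²/g_k²)|P| + w) · e^{α₅c|Λ|} ·
e^{α₅(1+2cg)|N|}`, `α₅ = 2θ′ + γ₂ + a` (`B13CauchyDecay.norm_term214_le_215` + `norm_core214_F214_le_K_of_216`).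
[cite: Balaban1988RG2Cluster, (2.14)–(2.15) p.15, (2.16)–(2.22) p.16, (2.23)–(2.26) p.17] -/
theorem norm_term214_le_226_of_216 (hρ : WeightHyp 0 ρ) (hρs : ∀ x y : S, ρ x y = ρ y x)
    (hKc : ∀ b : ℝ, 0 < b → ∀ (T : Finset S) (x : S), ∑ y ∈ T, Real.exp (-(b * ρ x y)) ≤ Kc b)
    (hKc0 : ∀ b : ℝ, 0 < b → 0 ≤ Kc b)
    {κ₁ : ℝ} (hκ₁ : 1 ≤ κ₁) (Rτ : κ → ℝ) (hRτ : ∀ Y, 2 ≤ Rτ Y)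
    {Uσ Uτ : Set ℂ} (hUσ : IsOpen Uσ) (hUτ : IsOpen Uτ) (hUexp : closedBall (0 : ℂ) (Real.exp κ₁) ⊆ Uσ)
    (hUtau : ∀ Y, closedBall (0 : ℂ) (Rτ Y) ⊆ Uτ) {r : ℝ} (hr : 0 < r) (hr' : r ≤ Real.exp κ₁ - 1)
    (hsubτ : ∀ s ∈ Set.uIcc (0 : ℝ) 1, closedBall (s : ℂ) r ⊆ Uτ)
    (A : (ι → ℂ) → Matrix Λ Λ ℂ) (Γ : (ι → ℂ) → (Λ ⊕ C₀ → ℝ) → (Λ → ℂ))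
    (cardP : ℕ) (χY₀ χcP : (Λ → ℝ) → ℝ) (hχ0 : ∀ B, 0 ≤ χY₀ B) (hχc0 : ∀ B, 0 ≤ χcP B) (Dfam : Finset κ)
    (V : κ → (Λ → ℝ) → ℂ)
    (hΨσ : ∀ τ : κ → ℂ, (∀ j, τ j ∈ Uτ) → SepHolOn Uσ (fun σ => core214 A Γ (F214 cardP χY₀ χcP Dfam V) σ τ))
    (hΨτ : ∀ σ : ι → ℂ, (∀ j, σ j ∈ Uσ) → SepHolOn Uτ (fun τ => core214 A Γ (F214 cardP χY₀ χcP Dfam V) σ τ))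
    {C : Matrix Λ Λ ℝ} (hC : C.PosDef) (Γ₀ : Matrix Λ (Λ ⊕ C₀) ℝ)
    (hAs : ∀ σ : ι → ℂ, (∀ j, ‖σ j‖ ≤ Real.exp κ₁) → (A σ).IsSymm)
    (hA : ∀ σ : ι → ℂ, (∀ j, ‖σ j‖ ≤ Real.exp κ₁) → ((A σ).map Complex.re).PosDef)
    (hΓc : ∀ σ : ι → ℂ, (∀ j, ‖σ j‖ ≤ Real.exp κ₁) → Continuous (Γ σ))
    {γ₂ rP a w : ℝ} (qP : (Λ → ℝ) → ℝ)
    (h222 : ∀ B, χY₀ B * χcP B ≤ Real.exp (-(γ₂ / 2 * rP ^ 2 * cardP) + γ₂ / 2 * qP B)) (hγ₂ : 0 ≤ γ₂)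
    (hqP : ∀ B, qP B ≤ B ⬝ᵥ B) (h220R : ∀ B, ∑ Y ∈ Dfam, Rτ Y * ‖V Y B‖ ≤ a / 2 * (B ⬝ᵥ B) + w) (ha0 : 0 ≤ a)
    {θ kap K₀ κC : ℝ} (hθ : 0 ≤ θ) (hkap : 0 < kap) (hK₀ : 0 ≤ K₀) (hκC : 0 < κC)
    (locΛ : Λ → S) (locN : Λ ⊕ C₀ → S) {m : ℕ}
    (hfibΛ : ∀ x : S, (Finset.univ.filter fun i => locΛ i = x).card ≤ m)
    (hfibN : ∀ x : S, (Finset.univ.filter fun j => locN j = x).card ≤ m)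
    (R₁ : (ι → ℂ) → Matrix (Λ ⊕ C₀) (Λ ⊕ C₀) ℝ) (R₃ : (ι → ℂ) → Matrix Λ (Λ ⊕ C₀) ℝ)
    (hdef1 : ∀ σ : ι → ℂ, (∀ j, ‖σ j‖ ≤ Real.exp κ₁) → ∀ X : Λ ⊕ C₀ → ℝ,
      ((Γ σ X) ⬝ᵥ ((A σ)⁻¹ *ᵥ Γ σ X)).re = (Γ₀ *ᵥ X) ⬝ᵥ (C *ᵥ (Γ₀ *ᵥ X)) - X ⬝ᵥ (R₁ σ *ᵥ X))
    (h216R1 : ∀ σ : ι → ℂ, (∀ j, ‖σ j‖ ≤ Real.exp κ₁) →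
      ∀ b b', ‖R₁ σ b b'‖ ≤ θ * Real.exp (-(kap * ρ (locN b) (locN b'))))
    (h216E : ∀ σ : ι → ℂ, (∀ j, ‖σ j‖ ≤ Real.exp κ₁) →
      ∀ b b', ‖(A σ - C⁻¹.map (algebraMap ℝ ℂ)) b b'‖ ≤ θ * Real.exp (-(kap * ρ (locΛ b) (locΛ b'))))
    (hdef3 : ∀ σ : ι → ℂ, (∀ j, ‖σ j‖ ≤ Real.exp κ₁) →
      ∀ (X : Λ ⊕ C₀ → ℝ) (i : Λ), (Γ σ X i).re = ((Γ₀ + R₃ σ) *ᵥ X) i)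
    (h216R3 : ∀ σ : ι → ℂ, (∀ j, ‖σ j‖ ≤ Real.exp κ₁) →
      ∀ i j, ‖R₃ σ i j‖ ≤ θ * Real.exp (-(kap * ρ (locΛ i) (locN j))))
    (hC216 : ∀ b b', ‖C b b'‖ ≤ K₀ * Real.exp (-(κC * ρ (locΛ b) (locΛ b'))))
    (hsmallKθ : K₀ * (m * Kc κC) * (θ * (m * Kc kap)) < 1)
    {c g : ℝ} (hc0 : 0 ≤ c) (hc : ∀ k, hC.1.eigenvalues k ≤ c)
    (hαc : (2 * (θ * (m * Kc kap)) + (γ₂ + a)) * c ≤ 1 / 2) (hg : 0 ≤ g)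
    (hΓ : ∀ X : Λ ⊕ C₀ → ℝ, (Γ₀ *ᵥ X) ⬝ᵥ (C *ᵥ (Γ₀ *ᵥ X)) ≤ g * (X ⬝ᵥ X))
    (hsmall : (2 * (θ * (m * Kc kap)) + (γ₂ + a)) * (1 + 2 * c * g) ≤ 1 / 2)
    {lZ : List ι} (hlZ : lZ.Nodup) {lD : List κ} (hlD : lD.Nodup)
    {σ₀ : ι → ℂ} (hσ₀ : ∀ j, ‖σ₀ j‖ ≤ 1) {τ₀ : κ → ℂ} (hτ₀ : ∀ Y, ‖τ₀ Y‖ ≤ 1) :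
    ‖term214 r lZ lD (core214 A Γ (F214 cardP χY₀ χcP Dfam V)) σ₀ τ₀‖ ≤
      Real.exp (-(κ₁ - 1) * lZ.length) * (∏ Y ∈ lD.toFinset, 2 * (Rτ Y)⁻¹)
        * (Real.exp (2 * (K₀ * (m * Kc κC) * (θ * (m * Kc kap))
              * (1 + (1 - K₀ * (m * Kc κC) * (θ * (m * Kc kap)))⁻¹) / 2) * Fintype.card Λ)
          * Real.exp (-(γ₂ / 2 * rP ^ 2 * cardP) + w)
          * (Real.exp ((2 * (θ * (m * Kc kap)) + (γ₂ + a)) * c * Fintype.card Λ)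
            * Real.exp ((2 * (θ * (m * Kc kap)) + (γ₂ + a)) * (1 + 2 * c * g) * Fintype.card (Λ ⊕ C₀)))) :=
  norm_term214_le_215 hκ₁ Rτ hRτ hUσ hUτ hUexp hUtau hr hr' hsubτ hΨσ hΨτ
    (norm_core214_F214_le_K_of_216 hρ hρs hKc hKc0 A Γ hC Γ₀ (fun _ => Real.exp κ₁) Rτ hAs hA hΓc cardP χY₀ χcP
      hχ0 hχc0 Dfam V qP h222 hγ₂ hqP h220R ha0 hθ hkap hK₀ hκC locΛ locN hfibΛ hfibN R₁ R₃ hdef1 h216R1 h216E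
      hdef3 h216R3 hC216 hsmallKθ hc0 hc hαc hg hΓ hsmall)
    hlZ hlD hσ₀ hτ₀

end Assembly

/-! ## §5. (2.26) from the primitive objects, on an arbitrary located geometry -/

section Capstone

variable {S : Type*} [DecidableEq S] {ρ : S → S → ℝ} {Kc : ℝ → ℝ}
variable {Λ : Type} [Fintype Λ] [DecidableEq Λ] {C₀ : Type} [Fintype C₀] [DecidableEq C₀]
variable {ι κ : Type*} [DecidableEq ι] [DecidableEq κ]

/-- **(2.26) for the typed term (2.14) from the PRIMITIVE objects, bonds located in an arbitrary site space.**
Hypotheses: the site geometry (`ρ` a symmetric pseudo-distance with uniform lattice constant `Kc`); the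
Cauchy/analyticity data of `B13Bound226Assembly` (σ-radius `e^{κ₁}`, `κ₁ ≥ 1`; τ-radii `R_τ(Y) ≥ 2`; separate
holomorphy of `∫dμ₀(X)|_Z (lines 2–4)`; base points in the unit polydiscs); the (2.22) and (2.20) shapes; and, uniformly
for the `σ` of the σ-polydisc: `A(σ)` symmetric with `Re A(σ) ≻ 0`; the `Γ`-operator LINEAR, `Γ(σ)X = G(σ)·X`; ENTRYWISE
bounds on located bonds (`Λ` = bonds of `Z₀`, `N = Λ ⊕ C₀` = bonds of `Z`, each with `≤ m` per site) at rate `κ`: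
localisation of `G(σ)` (`K_G`), `Γ₀` (`K_Γ`), `C_σ = A(σ)⁻¹` (`K_{Cσ}`), `C` (`K₀`), and (2.16)-type bounds of the
differences `G(σ) − Γ₀` (`θ_Γ`), `A(σ)⁻¹ − C` (`θ_C`), `A(σ) − C⁻¹` (`θ_E`); rates `κ > κ′ > κ″ > 0`; a common majorant `θ`
of `θ_E`, `θ_Γ` and the `R₁`-constant `m·Kc(κ−κ′)·m·Kc(κ′−κ″)·(θ_ΓK_{Cσ}K_G + K_Γθ_CK_G + K_ΓK₀θ_Γ)`; smallness
`K′θ′ < 1` (`K′ = K₀m·Kc(κ)`, `θ′ = θm·Kc(κ″)`), `α₅c ≤ ½`, `α₅(1+2cg) ≤ ½` (`α₅ = 2θ′ + γ₂ + a`).  Conclusion: (2.26),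
`|(2.14)| ≤ exp(−(κ₁ − 1)|lZ|)·[Π_{Y∈𝐃} 2/R_τ(Y)]·e^{2η|Λ|}·exp(−½γ₂(ε₁²/g_k²)|P| + w)·e^{α₅c|Λ|}·e^{α₅(1+2cg)|N|}` —
`norm_term214_le_226_of_216` with `R₁ := Γ₀ᵀCΓ₀ − Re(G(σ)ᵀA(σ)⁻¹G(σ))` (`B13Eq216FirstForm.hdef1_of_linear` /
`h216R1_of_factors`), `R₃ := Re G(σ) − Γ₀` (`B13Bound226Primitive.hdef3_of_linear` / `h216R3_of_diff`), `hΓc` :=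
`B13Bound226Primitive.continuous_of_linear`.  At `S = ℤ^ν`, `ρ = |·−·|₁`, `Kc(b) = (1+2/b)^ν` (§6) this is
`B13Bound226Primitive.norm_term214_le_226_of_primitives`. [cite: Balaban1988RG2Cluster, (2.14)–(2.15) p.15, (2.16)–(2.22) p.16, (2.23)–(2.26) p.17] -/
theorem norm_term214_le_226_of_primitives (hρ : WeightHyp 0 ρ) (hρs : ∀ x y : S, ρ x y = ρ y x)
    (hKc : ∀ b : ℝ, 0 < b → ∀ (T : Finset S) (x : S), ∑ y ∈ T, Real.exp (-(b * ρ x y)) ≤ Kc b)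
    (hKc0 : ∀ b : ℝ, 0 < b → 0 ≤ Kc b)
    {κ₁ : ℝ} (hκ₁ : 1 ≤ κ₁) (Rτ : κ → ℝ) (hRτ : ∀ Y, 2 ≤ Rτ Y)
    {Uσ Uτ : Set ℂ} (hUσ : IsOpen Uσ) (hUτ : IsOpen Uτ) (hUexp : closedBall (0 : ℂ) (Real.exp κ₁) ⊆ Uσ)
    (hUtau : ∀ Y, closedBall (0 : ℂ) (Rτ Y) ⊆ Uτ) {r : ℝ} (hr : 0 < r) (hr' : r ≤ Real.exp κ₁ - 1)
    (hsubτ : ∀ s ∈ Set.uIcc (0 : ℝ) 1, closedBall (s : ℂ) r ⊆ Uτ)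
    (A : (ι → ℂ) → Matrix Λ Λ ℂ) (Γ : (ι → ℂ) → (Λ ⊕ C₀ → ℝ) → (Λ → ℂ))
    (cardP : ℕ) (χY₀ χcP : (Λ → ℝ) → ℝ) (hχ0 : ∀ B, 0 ≤ χY₀ B) (hχc0 : ∀ B, 0 ≤ χcP B) (Dfam : Finset κ)
    (V : κ → (Λ → ℝ) → ℂ)
    (hΨσ : ∀ τ : κ → ℂ, (∀ j, τ j ∈ Uτ) → SepHolOn Uσ (fun σ => core214 A Γ (F214 cardP χY₀ χcP Dfam V) σ τ))
    (hΨτ : ∀ σ : ι → ℂ, (∀ j, σ j ∈ Uσ) → SepHolOn Uτ (fun τ => core214 A Γ (F214 cardP χY₀ χcP Dfam V) σ τ))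
    {C : Matrix Λ Λ ℝ} (hC : C.PosDef) (Γ₀ : Matrix Λ (Λ ⊕ C₀) ℝ)
    (hAs : ∀ σ : ι → ℂ, (∀ j, ‖σ j‖ ≤ Real.exp κ₁) → (A σ).IsSymm)
    (hA : ∀ σ : ι → ℂ, (∀ j, ‖σ j‖ ≤ Real.exp κ₁) → ((A σ).map Complex.re).PosDef)
    -- the Γ-operator is linear with kernel G(σ)
    (G : (ι → ℂ) → Matrix Λ (Λ ⊕ C₀) ℂ)
    (hlin : ∀ σ : ι → ℂ, (∀ j, ‖σ j‖ ≤ Real.exp κ₁) → ∀ X : Λ ⊕ C₀ → ℝ, Γ σ X = G σ *ᵥ fun j => (X j : ℂ))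
    {γ₂ rP a w : ℝ} (qP : (Λ → ℝ) → ℝ)
    (h222 : ∀ B, χY₀ B * χcP B ≤ Real.exp (-(γ₂ / 2 * rP ^ 2 * cardP) + γ₂ / 2 * qP B)) (hγ₂ : 0 ≤ γ₂)
    (hqP : ∀ B, qP B ≤ B ⬝ᵥ B) (h220R : ∀ B, ∑ Y ∈ Dfam, Rτ Y * ‖V Y B‖ ≤ a / 2 * (B ⬝ᵥ B) + w) (ha0 : 0 ≤ a)
    -- located bonds
    (locΛ : Λ → S) (locN : Λ ⊕ C₀ → S) {m : ℕ}
    (hfibΛ : ∀ x : S, (Finset.univ.filter fun i => locΛ i = x).card ≤ m)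
    (hfibN : ∀ x : S, (Finset.univ.filter fun j => locN j = x).card ≤ m)
    -- rates and constants
    {kap kap' kap'' θ θE θΓ θC KG KΓ KCs K₀ : ℝ} (hkap'' : 0 < kap'') (h1 : kap'' < kap') (h2 : kap' < kap)
    (hθE : 0 ≤ θE) (hθΓ : 0 ≤ θΓ) (hθC : 0 ≤ θC) (hKG : 0 ≤ KG) (hKΓ : 0 ≤ KΓ) (hKCs : 0 ≤ KCs) (hK₀ : 0 ≤ K₀)
    (hθEle : θE ≤ θ) (hθΓle : θΓ ≤ θ)
    (hθR1le : (m * Kc (kap - kap')) * (m * Kc (kap' - kap''))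
      * (θΓ * KCs * KG + KΓ * θC * KG + KΓ * K₀ * θΓ) ≤ θ)
    -- uniform localisation of the primitive kernels (L17a)
    (hG : ∀ σ : ι → ℂ, (∀ j, ‖σ j‖ ≤ Real.exp κ₁) →
      ∀ b j, ‖G σ b j‖ ≤ KG * Real.exp (-(kap * ρ (locΛ b) (locN j))))
    (hΓ₀ : ∀ b j, ‖Γ₀ b j‖ ≤ KΓ * Real.exp (-(kap * ρ (locΛ b) (locN j))))
    (hCs : ∀ σ : ι → ℂ, (∀ j, ‖σ j‖ ≤ Real.exp κ₁) →
      ∀ b b', ‖(A σ)⁻¹ b b'‖ ≤ KCs * Real.exp (-(kap * ρ (locΛ b) (locΛ b'))))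
    (hC216 : ∀ b b', ‖C b b'‖ ≤ K₀ * Real.exp (-(kap * ρ (locΛ b) (locΛ b'))))
    -- the (2.16)-type differences of the primitive kernels (L16a)
    (hdΓ : ∀ σ : ι → ℂ, (∀ j, ‖σ j‖ ≤ Real.exp κ₁) →
      ∀ b j, ‖(G σ - Γ₀.map (algebraMap ℝ ℂ)) b j‖ ≤ θΓ * Real.exp (-(kap * ρ (locΛ b) (locN j))))
    (hdC : ∀ σ : ι → ℂ, (∀ j, ‖σ j‖ ≤ Real.exp κ₁) →
      ∀ b b', ‖((A σ)⁻¹ - C.map (algebraMap ℝ ℂ)) b b'‖ ≤ θC * Real.exp (-(kap * ρ (locΛ b) (locΛ b'))))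
    (hdE : ∀ σ : ι → ℂ, (∀ j, ‖σ j‖ ≤ Real.exp κ₁) →
      ∀ b b', ‖(A σ - C⁻¹.map (algebraMap ℝ ℂ)) b b'‖ ≤ θE * Real.exp (-(kap * ρ (locΛ b) (locΛ b'))))
    (hsmallKθ : K₀ * (m * Kc kap) * (θ * (m * Kc kap'')) < 1)
    -- the (2.24)–(2.25) smallness
    {c g : ℝ} (hc0 : 0 ≤ c) (hc : ∀ k, hC.1.eigenvalues k ≤ c)
    (hαc : (2 * (θ * (m * Kc kap'')) + (γ₂ + a)) * c ≤ 1 / 2) (hg : 0 ≤ g)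
    (hΓq : ∀ X : Λ ⊕ C₀ → ℝ, (Γ₀ *ᵥ X) ⬝ᵥ (C *ᵥ (Γ₀ *ᵥ X)) ≤ g * (X ⬝ᵥ X))
    (hsmall : (2 * (θ * (m * Kc kap'')) + (γ₂ + a)) * (1 + 2 * c * g) ≤ 1 / 2)
    {lZ : List ι} (hlZ : lZ.Nodup) {lD : List κ} (hlD : lD.Nodup)
    {σ₀ : ι → ℂ} (hσ₀ : ∀ j, ‖σ₀ j‖ ≤ 1) {τ₀ : κ → ℂ} (hτ₀ : ∀ Y, ‖τ₀ Y‖ ≤ 1) :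
    ‖term214 r lZ lD (core214 A Γ (F214 cardP χY₀ χcP Dfam V)) σ₀ τ₀‖ ≤
      Real.exp (-(κ₁ - 1) * lZ.length) * (∏ Y ∈ lD.toFinset, 2 * (Rτ Y)⁻¹)
        * (Real.exp (2 * (K₀ * (m * Kc kap) * (θ * (m * Kc kap''))
              * (1 + (1 - K₀ * (m * Kc kap) * (θ * (m * Kc kap'')))⁻¹) / 2) * Fintype.card Λ)
          * Real.exp (-(γ₂ / 2 * rP ^ 2 * cardP) + w)
          * (Real.exp ((2 * (θ * (m * Kc kap'')) + (γ₂ + a)) * c * Fintype.card Λ)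
            * Real.exp ((2 * (θ * (m * Kc kap'')) + (γ₂ + a)) * (1 + 2 * c * g)
              * Fintype.card (Λ ⊕ C₀)))) := by
  have hθ : 0 ≤ θ := hθE.trans hθEle
  have hkap : 0 < kap := hkap''.trans (h1.trans h2)
  have hkk : kap'' ≤ kap := (h1.trans h2).le
  -- R₁ and R₃ constructed from the primitive kernels
  refine norm_term214_le_226_of_216 hρ hρs hKc hKc0 hκ₁ Rτ hRτ hUσ hUτ hUexp hUtau hr hr' hsubτ A Γ cardP χY₀ χcP
    hχ0 hχc0 Dfam V hΨσ hΨτ hC Γ₀ hAs hA (fun σ hσ => continuous_of_linear (G σ) (Γ σ) (hlin σ hσ)) qP h222 hγ₂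
    hqP h220R ha0 hθ hkap'' hK₀ hkap locΛ locN hfibΛ hfibN
    (fun σ => Γ₀ᵀ * C * Γ₀ - ((G σ)ᵀ * (A σ)⁻¹ * G σ).map Complex.re)
    (fun σ => (G σ).map Complex.re - Γ₀)
    (fun σ hσ X => hdef1_of_linear (A σ) (G σ) (Γ σ) (hlin σ hσ) C Γ₀ X)
    (fun σ hσ b b' => ?_) (fun σ hσ b b' => ?_)
    (fun σ hσ X i => hdef3_of_linear (G σ) (Γ σ) (hlin σ hσ) Γ₀ X i)
    (fun σ hσ i j => ?_) hC216 hsmallKθ hc0 hc hαc hg hΓq hsmall hlZ hlD hσ₀ hτ₀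
  · -- h216R1: from the factor bounds, then to the common majorant θ
    have h := h216R1_of_factors hρ hρs hKc hKc0 hθΓ hθC hKG hKΓ hKCs hK₀ hkap''.le h1 h2 locΛ locN hfibΛ
      (hdΓ σ hσ) (hdC σ hσ) (hG σ hσ) hΓ₀ (hCs σ hσ) hC216 b b'
    exact h.trans (mul_le_mul_of_nonneg_right hθR1le (Real.exp_pos _).le)
  · -- h216E: rate κ → κ″, constant θ_E → θ
    have h := entry_bound_mono_rate hρ hθE hkk locΛ locΛ (hdE σ hσ) b b'
    exact h.trans (mul_le_mul_of_nonneg_right hθEle (Real.exp_pos _).le)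
  · -- h216R3: from G(σ) − Γ₀, rate κ → κ″, constant θ_Γ → θ
    have hmono : ∀ i j, ‖(G σ - Γ₀.map (algebraMap ℝ ℂ)) i j‖
        ≤ θ * Real.exp (-(kap'' * ρ (locΛ i) (locN j))) := fun i j =>
      (entry_bound_mono_rate hρ hθΓ hkk locΛ locN (hdΓ σ hσ) i j).trans
        (mul_le_mul_of_nonneg_right hθΓle (Real.exp_pos _).le)
    exact h216R3_of_diff hmono i j

end Capstone

/-! ## §6. The instance of record: `S = ℤ^ν`, `ρ = |·−·|₁`, `Kc(b) = (1 + 2/b)^ν` -/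

section L1Instance

variable {ν : ℕ}

/-- `|·−·|₁` on ℤ^ν is an admissible weight at rate 0 (`B13Eq216LatticeSum.weightHyp_l1dist` at `loc = id`).
[cite: Balaban1988RG2Cluster, (2.16) p.16 (the weight e^{−δ₀|b₋−b′₋|})] -/
theorem weightHyp_l1 : WeightHyp 0 (l1dist : (Fin ν → ℤ) → (Fin ν → ℤ) → ℝ) :=
  B13Eq216LatticeSum.weightHyp_l1dist le_rfl id

/-- `|·−·|₁` is symmetric. [folklore] [cite: Balaban1988RG2Cluster, (2.16) p.16] -/
theorem l1_symm : ∀ x y : Fin ν → ℤ, l1dist x y = l1dist y x := l1dist_comm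

/-- The uniform lattice constant of ℤ^ν in the ℓ¹ distance: `Σ_{y ∈ T} e^{−b|x − y|₁} ≤ (1 + 2/b)^ν` for every finite
`T ⊂ ℤ^ν` (`B2Lemma25Proof.sum_exp_neg_l1dist_le`) — the printed *"this yields a constant O(1)"*.
[cite: Balaban1988RG2Cluster, p.16 after (2.19)] -/
theorem kc_l1 : ∀ b : ℝ, 0 < b → ∀ (T : Finset (Fin ν → ℤ)) (x : Fin ν → ℤ),
    ∑ y ∈ T, Real.exp (-(b * l1dist x y)) ≤ (fun b : ℝ => (1 + 2 / b) ^ ν) b :=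
  fun _ hb T x => sum_exp_neg_l1dist_le hb x T

/-- The lattice constant `(1 + 2/b)^ν` is non-negative for `b > 0`. [folklore] [cite: Balaban1988RG2Cluster, p.16 after (2.19)] -/
theorem kc_l1_nonneg : ∀ b : ℝ, 0 < b → 0 ≤ (fun b : ℝ => (1 + 2 / b) ^ ν) b := fun b hb => by positivity

end L1Instance

end Literature.MathematicalPhysics.QuantumFieldTheory.Balaban1983to89.B13Bound226Located

end
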